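import Literature.MathematicalPhysics.QuantumFieldTheory.Balaban1983to89.Beta.RemainderDecay190SupNormLeaves
import Literature.MathematicalPhysics.QuantumFieldTheory.Balaban1983to89.Beta.RemainderFacFromActivities

/-!
# [Balaban1987RG1] (1.7) ∕ (1.21) ∕ (4.4) on the (4.4)-space MODEL with the (1.7) input AT THE ACTIVITY LEVEL: the
# leaf list `PolLeavesTFac190H` and the row-(D4) END from step objects whose ACTIVITIES are local through the window
# (`Beta.RemainderDecay190SupNormLeavesLocal`)

statement-level skeleton of published theorems with citation tags; proofs where landed; nothing here is a claim
about the Yang–Mills mass gap.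

HONEST FRAMING (cell rule).  Bookkeeping for the k-uniform remainder chain of row (D4) (`RemainderConst` ⇐ ONE
`ChainTFac190` instance, `Beta.RemainderDecay190`); discharges NOTHING of `BetaPertH`; NOT B12 Thm 2, NOT the continuum
limit, NOT Clay.  Unit `b2b-balaban-beta-an4` gen 95 (BINDER row D4 OWNER; cell pub-balaban).  Imports the two
generation-95 files `Beta.RemainderDecay190SupNormLeaves` (the leaf list on the model carrier from object-level
letters, `hfac` an input) and `Beta.RemainderFacFromActivities` (`hfac` from activity-level locality via (2.13)) ONLY;
nothing edited.  ONE COMPOSITION, no new idea: the two files meet at the leaf `hfac`.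

WHAT.  `nonempty_polLeavesTFac190H_supNorm_of_activities`: the hypotheses of
`RemainderDecay190SupNormLeaves.nonempty_polLeavesTFac190H_supNorm` with the window functionals `F Y` and their
factorization `hfac` REPLACED by window activity functionals `w Y W : (ι Y → ℂ) → ℂ` (one per localization domain W
inside Y, `TreeLengthCubeSystem.Dom Y.1`) and the eventual ACTIVITY-LEVEL locality `hloc` along the seam —
`(O n).H (W mod N n) (emb n (Y mod N n) v) = w Y W (restrictCLM (N n·M) (e Y) v)` on the α₂-ball; the window functional
is then WRITTEN: `F Y u := locE (Touch Y.1) (·) (fun W => w Y W u) Y.1` ((2.13) over the window), and so is the read-out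
`a`.  `…_of_exists` takes the (190)-socket in generation 94's `∃ D, hrule` shape; `remainderConst_of_stepObjects_activities_supNorm`
is the row-(D4) END per (scale, history) in this currency.  AFTER THIS FILE the (1.7) ∕ (1.21) inputs of row (D4) on the
model carrier are: activity-level locality `hloc` ([II] p. 15 with the restricted propagators of (2.16) ff.) and the
periodised-kernel letters `hS` ∕ `hdec` ∕ `hker` ([I] (5.10) shape) — both statements about NODE O's objects, not about 𝐄.
WHAT IS *NOT* DONE: no object of Bałaban's constructed; row D4 class UNCHANGED (instance 0∕1; critical-path width 0 =
NODE O; D4 DISCHARGE NO DATE).  No `def`, no named fact, no `sorry`, standard axioms.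
HONEST DEPENDENCY: continuum YM on T⁴ ⇐ BetaPertH ∧ nine spine estimates (0/9 proved); BetaPertH ⇐ (D1) ∧ (D4) ∧
CAP+tail; G-an2-4 gates asym, D1 and NE2/3/4.

Sources: [I] = T. Bałaban, Commun. Math. Phys. **109** (1987) 249–301 [Balaban1987RG1], (1.7) p. 261, (1.21)–(1.22)
p. 264, (4.4) p. 281, (4.35) p. 290, (5.10) p. 293; [II] = T. Bałaban, Commun. Math. Phys. **116** (1988) 1–22
[Balaban1988RG2Cluster], (2.11)–(2.13) p. 14, p. 15, Lemma 3 (2.38) p. 20; [15] = Commun. Math. Phys. **102** (1985)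
277–309 [Balaban1985Variational], (190) p. 308.
-/

namespace Literature.MathematicalPhysics.QuantumFieldTheory.Balaban1983to89.Beta.RemainderDecay190SupNormLeavesLocal

open Literature.MathematicalPhysics.QuantumFieldTheory.Balaban1983to89
open Literature.MathematicalPhysics.QuantumFieldTheory.Balaban1983to89.B13ScaleTransfer (Pt)
open Literature.MathematicalPhysics.QuantumFieldTheory.Balaban1983to89.B13Resummation (locE)
open Literature.MathematicalPhysics.QuantumFieldTheory.Balaban1983to89.TreeLengthTorus (TPt TDom proj)
open Literature.MathematicalPhysics.QuantumFieldTheory.Balaban1983to89.TreeLengthCubeSystem (Dom Touch)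
open Literature.MathematicalPhysics.QuantumFieldTheory.Balaban1983to89.B12Decay510 (mixedDeriv)
open Literature.MathematicalPhysics.QuantumFieldTheory.Balaban1983to89.B12Decay510Lattice (cubeOf)
open Literature.MathematicalPhysics.QuantumFieldTheory.Balaban1983to89.B12Decay510Torus (tcubeOf)
open Literature.MathematicalPhysics.QuantumFieldTheory.Balaban1983to89.Beta.RemainderLimitTorus (LDom tproj limKernel)
open Literature.MathematicalPhysics.QuantumFieldTheory.Balaban1983to89.Beta.RemainderLocalityHolo (PolLeavesTFac190H)
open Literature.MathematicalPhysics.QuantumFieldTheory.Balaban1983to89.Beta.RemainderDecay190 (Data190 Consts190)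
open Literature.MathematicalPhysics.QuantumFieldTheory.Balaban1983to89.Beta.RemainderChain (RemainderConst)
open Literature.MathematicalPhysics.QuantumFieldTheory.Balaban1983to89.Beta.RemainderChainLattice
  (CondsL SignsL remCoeffL)
open Literature.MathematicalPhysics.QuantumFieldTheory.Balaban1983to89.Beta.RemainderStepAdapterHolo (StepObjectD4)
open Literature.MathematicalPhysics.QuantumFieldTheory.Balaban1983to89.Beta (Kernel₂ IsPeriodic₂ Decay₂ periodise₂)
open Literature.MathematicalPhysics.QuantumFieldTheory.Balaban1983to89.Beta.RemainderLocalitySockets (restrictCLM)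
open Literature.MathematicalPhysics.QuantumFieldTheory.Balaban1983to89.Beta.RemainderDecay190SupNormLeaves
  (nonempty_polLeavesTFac190H_supNorm remainderConst_of_stepObjects_supNorm)
open Literature.MathematicalPhysics.QuantumFieldTheory.Balaban1983to89.Beta.RemainderFacFromActivities
  (eventually_fac_of_activities)
open Metric Set Filter Topology

variable {d M : ℕ} [NeZero M]

open Classical in
/-- **THE LEAF LIST ON THE MODEL CARRIER WITH THE (1.7) INPUT AT THE ACTIVITY LEVEL.**  The hypotheses of
`RemainderDecay190SupNormLeaves.nonempty_polLeavesTFac190H_supNorm` verbatim, EXCEPT that the window functionals `F Y`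
and their factorization `hfac` are replaced by window ACTIVITY functionals `w Y W` (W a localization domain inside Y)
and the eventual activity-level locality `hloc` along the seam, on the α₂-ball, in the `restrictCLM` currency.  Output:
`Nonempty (PolLeavesTFac190H d M a c ℓ α₂ q)` with `F Y u := locE (Touch Y.1) (·) (fun W => w Y W u) Y.1` and the
read-out `a Y z := Re ∂²(F Y)(0)[(S Y(e Y i, 0))_i, (S Y(e Y i, z))_i]` WRITTEN IN THE STATEMENT
(`RemainderFacFromActivities.eventually_fac_of_activities` feeds `hfac`).  Nothing of Bałaban's is constructed.
[cite: Balaban1987RG1, (1.7) p.261, (1.21) p.264, (4.4) p.281, (4.35) p.290, (5.10) p.293; Balaban1988RG2Cluster, (2.13) p.14, p.15 and (2.38) p.20; Balaban1985Variational, (190) p.308] -/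
theorem nonempty_polLeavesTFac190H_supNorm_of_activities (N : ℕ → ℕ) [hN : ∀ n, NeZero (N n)]
    (hNlim : Tendsto N atTop atTop)
    (O : (n : ℕ) → StepObjectD4 d (N n)) (c : B13.Consts) (ℓ α₂ : ℝ) (q : Consts190)
    (h3 : ∀ n, (O n).Lemma3OnH c ℓ) (hC : CondsL d c ℓ) (hA : 0 ≤ c.C3act * c.ε₁) (hα₂ : 0 < α₂)
    (emb : (n : ℕ) → TDom d (N n) → (TPt d (N n * M) → ℂ) → (O n).Φ)
    (hemb : ∀ n X, ∀ v ∈ ball (0 : TPt d (N n * M) → ℂ) α₂, emb n X v ∈ (O n).sp2 X)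
    (hH : ∀ n (X Z : TDom d (N n)), Z.1 ⊆ X.1 →
      DifferentiableOn ℂ (fun v => (O n).H Z (emb n X v)) (ball 0 α₂))
    (D : Data190 d M N (fun n => TPt d (N n * M) → ℂ) q)
    (dH : (n : ℕ) → (TPt d (N n * M) → ℝ) →ₗ[ℝ] (TPt d (N n * M) → ℝ))
    (hrule : ∀ (n : ℕ) (X : TDom d (N n)) (x : TPt d (N n * M)),
      D.hn n X x = fun x' : TPt d (N n * M) =>
        if tcubeOf (N n) M x' ∈ X.1 then ((dH n (Pi.single x (1 : ℝ)) x' : ℝ) : ℂ) else 0)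
    {ι : LDom d → Type} [∀ Y, Fintype (ι Y)] (e : (Y : LDom d) → ι Y → Pt d)
    (he : ∀ Y i, cubeOf M (e Y i) ∈ Y.1) (hinj : ∀ Y, Function.Injective (e Y))
    (w : (Y : LDom d) → Dom Y.1 → (ι Y → ℂ) → ℂ)
    (hloc : ∀ Y : LDom d, ∀ᶠ n in atTop, ∀ W : Dom Y.1, ∀ v ∈ ball (0 : TPt d (N n * M) → ℂ) α₂,
      (O n).H (tproj (N n) (⟨W.1, W.2.2⟩ : LDom d)) (emb n (tproj (N n) Y) v) =
        w Y W (restrictCLM (N n * M) (e Y) v))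
    {S : LDom d → Kernel₂ d} {C δ : ℝ}
    (hS : ∀ Y n, IsPeriodic₂ (N n * M) (S Y)) (hdec : ∀ Y, Decay₂ (S Y) C δ) (hδ : 0 < δ)
    (hker : ∀ (Y : LDom d) (n : ℕ) (i : ι Y) (x : Pt d),
      dH n (Pi.single (proj (N n * M) x) (1 : ℝ)) (proj (N n * M) (e Y i)) =
        periodise₂ (N n * M) (S Y) (proj (N n * M) (e Y i)) (proj (N n * M) x)) :
    Nonempty (PolLeavesTFac190H d M
      (fun Y z => (mixedDeriv (fun u : ι Y → ℂ => locE (Touch Y.1) (fun W : Dom Y.1 => W.1) (fun W => w Y W u) Y.1)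
        (fun i => (S Y (e Y i) 0 : ℂ)) (fun i => (S Y (e Y i) z : ℂ))).re) c ℓ α₂ q) :=
  nonempty_polLeavesTFac190H_supNorm N hNlim O c ℓ α₂ q h3 hC hA hα₂ emb hemb hH D dH hrule e he hinj
    (fun Y u => locE (Touch Y.1) (fun W : Dom Y.1 => W.1) (fun W => w Y W u) Y.1)
    (fun Y => eventually_fac_of_activities N hNlim O emb (fun n => restrictCLM (N n * M) (e Y))
      (fun n => ball (0 : TPt d (N n * M) → ℂ) α₂) Y (w Y) (hloc Y))
    hS hdec hδ hker

open Classical in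
/-- **The same with the (190)-socket in generation 94's EXISTENCE shape** `∃ D, hrule`.
[cite: Balaban1985Variational, (182)-(190) pp.307-308; Balaban1987RG1, (1.7) p.261, (1.21) p.264, (4.4) p.281; Balaban1988RG2Cluster, (2.13) p.14] -/
theorem nonempty_polLeavesTFac190H_supNorm_of_activities_of_exists (N : ℕ → ℕ) [hN : ∀ n, NeZero (N n)]
    (hNlim : Tendsto N atTop atTop)
    (O : (n : ℕ) → StepObjectD4 d (N n)) (c : B13.Consts) (ℓ α₂ : ℝ) (q : Consts190)
    (h3 : ∀ n, (O n).Lemma3OnH c ℓ) (hC : CondsL d c ℓ) (hA : 0 ≤ c.C3act * c.ε₁) (hα₂ : 0 < α₂)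
    (emb : (n : ℕ) → TDom d (N n) → (TPt d (N n * M) → ℂ) → (O n).Φ)
    (hemb : ∀ n X, ∀ v ∈ ball (0 : TPt d (N n * M) → ℂ) α₂, emb n X v ∈ (O n).sp2 X)
    (hH : ∀ n (X Z : TDom d (N n)), Z.1 ⊆ X.1 →
      DifferentiableOn ℂ (fun v => (O n).H Z (emb n X v)) (ball 0 α₂))
    (dH : (n : ℕ) → (TPt d (N n * M) → ℝ) →ₗ[ℝ] (TPt d (N n * M) → ℝ))
    (hD : ∃ D : Data190 d M N (fun n => TPt d (N n * M) → ℂ) q,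
      ∀ (n : ℕ) (X : TDom d (N n)) (x : TPt d (N n * M)),
        D.hn n X x = fun x' : TPt d (N n * M) =>
          if tcubeOf (N n) M x' ∈ X.1 then ((dH n (Pi.single x (1 : ℝ)) x' : ℝ) : ℂ) else 0)
    {ι : LDom d → Type} [∀ Y, Fintype (ι Y)] (e : (Y : LDom d) → ι Y → Pt d)
    (he : ∀ Y i, cubeOf M (e Y i) ∈ Y.1) (hinj : ∀ Y, Function.Injective (e Y))
    (w : (Y : LDom d) → Dom Y.1 → (ι Y → ℂ) → ℂ)
    (hloc : ∀ Y : LDom d, ∀ᶠ n in atTop, ∀ W : Dom Y.1, ∀ v ∈ ball (0 : TPt d (N n * M) → ℂ) α₂,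
      (O n).H (tproj (N n) (⟨W.1, W.2.2⟩ : LDom d)) (emb n (tproj (N n) Y) v) =
        w Y W (restrictCLM (N n * M) (e Y) v))
    {S : LDom d → Kernel₂ d} {C δ : ℝ}
    (hS : ∀ Y n, IsPeriodic₂ (N n * M) (S Y)) (hdec : ∀ Y, Decay₂ (S Y) C δ) (hδ : 0 < δ)
    (hker : ∀ (Y : LDom d) (n : ℕ) (i : ι Y) (x : Pt d),
      dH n (Pi.single (proj (N n * M) x) (1 : ℝ)) (proj (N n * M) (e Y i)) =
        periodise₂ (N n * M) (S Y) (proj (N n * M) (e Y i)) (proj (N n * M) x)) :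
    Nonempty (PolLeavesTFac190H d M
      (fun Y z => (mixedDeriv (fun u : ι Y → ℂ => locE (Touch Y.1) (fun W : Dom Y.1 => W.1) (fun W => w Y W u) Y.1)
        (fun i => (S Y (e Y i) 0 : ℂ)) (fun i => (S Y (e Y i) z : ℂ))).re) c ℓ α₂ q) := by
  obtain ⟨D, hrule⟩ := hD
  exact nonempty_polLeavesTFac190H_supNorm_of_activities N hNlim O c ℓ α₂ q h3 hC hA hα₂ emb hemb hH D dH hrule e
    he hinj w hloc hS hdec hδ hker

open Classical in
/-- **HOW (D4) CLOSES ON THE MODEL CARRIER WITH THE (1.7) INPUT AT THE ACTIVITY LEVEL, in one statement**: as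
`RemainderDecay190SupNormLeaves.remainderConst_of_stepObjects_supNorm`, per (scale, history), with the window
functionals and `hfac` replaced by window activity functionals `w k p Y W` and the eventual activity-level locality
`hloc`; the (1.22) identification `beta1_eq` against the WRITTEN read-out; N1–N3.  Nothing of Bałaban's is asserted.
[cite: Balaban1987RG1, (1.22) p.264, (1.7) p.261, (4.4) p.281 and (5.10) p.293; Balaban1988RG2Cluster, (2.13) p.14, p.15 and (2.38) p.20; Balaban1985Variational, (190) p.308] -/
theorem remainderConst_of_stepObjects_activities_supNorm {μ ν : Fin d} {β : FlowStep.HBeta}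
    (Sβ : B12Beta.OneLoopSplit β) {γ : ℝ} {c : B13.Consts} {ℓ α₂ : ℝ} {q : Consts190}
    (hC : CondsL d c ℓ) (h22 : c.R22gen ℓ) (hq : q.Valid c.δ₀) (hs : SignsL c α₂ q.B₃)
    (N : (k : ℕ) → (Fin (k + 1) → ℝ) → ℕ → ℕ) (hN : ∀ k p n, NeZero (N k p n))
    (hNlim : ∀ k p, Tendsto (N k p) atTop atTop)
    (O : (k : ℕ) → (p : Fin (k + 1) → ℝ) → (n : ℕ) → StepObjectD4 d (N k p n))
    (h3 : ∀ k p n, (O k p n).Lemma3OnH c ℓ)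
    (emb : (k : ℕ) → (p : Fin (k + 1) → ℝ) → (n : ℕ) → TDom d (N k p n) →
      (TPt d (N k p n * M) → ℂ) → (O k p n).Φ)
    (hemb : ∀ k p n X, ∀ v ∈ ball (0 : TPt d (N k p n * M) → ℂ) α₂, emb k p n X v ∈ (O k p n).sp2 X)
    (hH : ∀ k p n (X Z : TDom d (N k p n)), Z.1 ⊆ X.1 →
      DifferentiableOn ℂ (fun v => (O k p n).H Z (emb k p n X v)) (ball 0 α₂))
    (dH : (k : ℕ) → (p : Fin (k + 1) → ℝ) → (n : ℕ) →
      (TPt d (N k p n * M) → ℝ) →ₗ[ℝ] (TPt d (N k p n * M) → ℝ))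
    (hD : ∀ k p, ∃ D : Data190 d M (N k p) (fun n => TPt d (N k p n * M) → ℂ) q,
      ∀ (n : ℕ) (X : TDom d (N k p n)) (x : TPt d (N k p n * M)),
        D.hn n X x = fun x' : TPt d (N k p n * M) =>
          if tcubeOf (N k p n) M x' ∈ X.1 then ((dH k p n (Pi.single x (1 : ℝ)) x' : ℝ) : ℂ) else 0)
    {ι : LDom d → Type} [∀ Y, Fintype (ι Y)] (e : (Y : LDom d) → ι Y → Pt d)
    (he : ∀ Y i, cubeOf M (e Y i) ∈ Y.1) (hinj : ∀ Y, Function.Injective (e Y))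
    (w : (k : ℕ) → (p : Fin (k + 1) → ℝ) → (Y : LDom d) → Dom Y.1 → (ι Y → ℂ) → ℂ)
    (hloc : ∀ k p (Y : LDom d), ∀ᶠ n in atTop, ∀ W : Dom Y.1, ∀ v ∈ ball (0 : TPt d (N k p n * M) → ℂ) α₂,
      (O k p n).H (tproj (N k p n) (⟨W.1, W.2.2⟩ : LDom d)) (emb k p n (tproj (N k p n) Y) v) =
        w k p Y W (restrictCLM (N k p n * M) (e Y) v))
    (Sk : (k : ℕ) → (Fin (k + 1) → ℝ) → LDom d → Kernel₂ d) (C δ : (k : ℕ) → (Fin (k + 1) → ℝ) → ℝ)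
    (hS : ∀ k p Y n, IsPeriodic₂ (N k p n * M) (Sk k p Y)) (hdec : ∀ k p Y, Decay₂ (Sk k p Y) (C k p) (δ k p))
    (hδ : ∀ k p, 0 < δ k p)
    (hker : ∀ k p (Y : LDom d) (n : ℕ) (i : ι Y) (x : Pt d),
      dH k p n (Pi.single (proj (N k p n * M) x) (1 : ℝ)) (proj (N k p n * M) (e Y i)) =
        periodise₂ (N k p n * M) (Sk k p Y) (proj (N k p n * M) (e Y i)) (proj (N k p n * M) x))
    (beta1_eq : ∀ k p, p ∈ B12Beta.HistBox γ k →
      Sβ.β1 k p = B12Beta.secondMoment (fun _ _ => limKernel fun Y z =>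
        (mixedDeriv (fun u : ι Y → ℂ => locE (Touch Y.1) (fun W : Dom Y.1 => W.1) (fun W => w k p Y W u) Y.1)
          (fun i => (Sk k p Y (e Y i) 0 : ℂ)) (fun i => (Sk k p Y (e Y i) z : ℂ))).re) μ ν) :
    RemainderConst Sβ γ (c.ε₁ * remCoeffL d M c α₂ q.B₃) :=
  remainderConst_of_stepObjects_supNorm Sβ hC h22 hq hs N hN hNlim O h3 emb hemb hH dH hD e he hinj
    (fun k p Y u => locE (Touch Y.1) (fun W : Dom Y.1 => W.1) (fun W => w k p Y W u) Y.1)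
    (fun k p Y => eventually_fac_of_activities (N k p) (hNlim k p) (O k p) (emb k p)
      (fun n => restrictCLM (N k p n * M) (e Y)) (fun n => ball (0 : TPt d (N k p n * M) → ℂ) α₂) Y (w k p Y)
      (hloc k p Y))
    Sk C δ hS hdec hδ hker beta1_eq

end Literature.MathematicalPhysics.QuantumFieldTheory.Balaban1983to89.Beta.RemainderDecay190SupNormLeavesLocal
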